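import Summits.QuantumFields.BalabanUV.T4Continuum.Support.NE3LinearNormalPartPreSizes
import HarnessLib

/-!
# T⁴ programme, node NE3 — census R26′, step 2d-α: THE PRE-SIZES OF THE LINEAR NORMAL PART FROM THE TWO SUMMED COARSE SIZES OF `φ`
# (the Π-REG majorant `LocalSupMajorant` REPLACED by its only two consequences, which the remainder towers supply WITHOUT regularity)

Cell `pub-balaban-gaps` (YM blitz, track G2, seat `ne3`, unit `pub-balaban-gaps-ne3`; writer prover-pub-balaban-gaps-ne3-g4-0, 2026-08-23), census
`run/shared/lean/pub/pub-balaban-gaps/ne/NE3.md` §4 R26′ ∕ §10 F8.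

WHAT.  `NE3LinearNormalPartPreSizes.preSizes_of_letters` reads the (Π-REG) majorant `m` (hypothesis shape `LocalSupMajorant`, B11 Thm 1∕Prop 2 regularity TYPE, asserted for
nothing) ONLY through the two summed coarse sizes (its lines (a)(b), `dirSq_coarse_le`∕`dirL1_coarse_le`):
`M^d·dirSq φ (periodBox N) ≤ C₂²α₀²M⁴·C²·T` and `M^d·dirL1 φ (periodBox N) ≤ C₂M²·C²·T` (`T = dirSq X₀ F`, `M = L^k`).  THIS FILE states the same three pre-sizes with
THOSE TWO LINES AS THE HYPOTHESES, with independent letters `P` (`M^d·dirSq φ ≤ P²α₀²M⁴·T`) and `Q` (`M^d·dirL1 φ ≤ Q·M²·T`); the proof is that theorem's, verbatim after its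
lines (a)(b).  The remainder towers `RemainderTowerB8.sqrt_l2sq_QbarIter_le` (ℓ²) and `RemainderL1FinalB8.dirL1_QbarIter_le_quadratic` (ℓ¹, quadratic) supply exactly these two
lines for `φ = QbarIter L (j+1) W Z`, `X₀ = Z`, `α₀ = sup‖Z‖`, with k-free `P`, `Q` at `d = 4` (`M^d·(ρL)^{2j} = M⁴·L^{d−4}`, `M^d·L^{(2−d)j} = M²·L^{d−2}`) — so the supplier
`SupplierB8Level` can be re-wired without the (Π-REG) leaf (step 2d-β).

CONTENT (0 sorry, 0 def): **`preSizes_of_coarseSizes`** [folklore].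

HONEST FRAMING.  Arithmetic on hypothesis shapes; NOTHING of Bałaban's is proved; **NE3 is NOT proved**; spine PROVED 0∕9; finite T⁴ rung (B)+1 — NOT continuum YM on ℝ⁴, NOT
infinite volume, NOT mass gap, NOT `BetaPertH`, NOT Clay.  PLACEMENT: `Summits/QuantumFields/BalabanUV/T4Continuum/Spine/NE3/`.
-/

set_option autoImplicit false

open scoped BigOperators Matrix.Norms.L2Operator
open NormedSpace Finset

namespace Summit.QuantumFields.BalabanUV.T4Continuum.NE3.PreSizesOfSizesB8

open Literature.MathematicalPhysics.QuantumFieldTheory.Balaban1983to89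
open B7Prop1Explicit B7Prop2Explicit B7Prop1Local
open T4AveragingDeficitWall (IsUnitaryCfg curl curlSq dirSq dirL1)
open T4AveragingDeficitWallBoundary (periodBox)
open MinimalActionLevels (perWin)
open NE3EnergyWeightedShapes (energyNormW energyNormW_nonneg)
open NE3EnergyHessContTwoTerm (curlSq_nonneg dirSq_nonneg)
open NE3LocalCrudeWPair (dirSq_le_pow_sq_mul_energyNormW_sq)
open AveragingDeficitDerivCore (dirL1_nonneg)
open NE3ProductPathBounds (energySq_nonneg)
open NE3LinearNormalPartPreSizes (dirSq_sub_le_two)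

noncomputable section

variable {d : ℕ} {n : Type*} [Fintype n] [DecidableEq n]

/-- **PRE-SIZES OF A LANDAU LINEAR NORMAL PART FROM THE TWO SUMMED COARSE SIZES OF `φ`** (= `preSizes_of_letters` with its lines (a)(b) as hypotheses and independent letters):
with `M = L^k`, `F = periodBox (N·M)`, `T = dirSq X₀ F`, `EX = ‖Nn − X₀‖_w`: from (R1)–(R4) (the one-step letters of `Nn` against `φ`), the two coarse sizes
`M^d·dirSq φ (periodBox N) ≤ P²·α₀²·M⁴·T`, `M^d·dirL1 φ (periodBox N) ≤ Q·M²·T`, the smallness `2(c₁+c₂)P²(α₀M)² ≤ 1∕2` and `(α₀+αN)·M ≤ 1`: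
**(N1) `‖Nn‖_w ≤ 2√(c₁+c₂)·P·(α₀M)·EX`, (N2) `a·Σ_{perWin}‖curl_W Nn‖ ≤ 4c₃·Q·(aM²)·EX²`, (N3) `a·((α₀+αN)·dirL1 Nn F) ≤ 4c₄·Q·(aM²)·EX²`.** [folklore] -/
theorem preSizes_of_coarseSizes {L N : ℕ} (hL : 1 ≤ L) (k : ℕ) (W : Site d → Fin d → (Matrix n n ℂ)ˣ)
    {X₀ Nn : Site d → Fin d → Matrix n n ℂ} {φ : Site d → Fin d → Matrix n n ℂ}
    {α₀ αN P Q c₁ c₂ c₃ c₄ a : ℝ} (hα₀ : 0 ≤ α₀) (hαN : 0 ≤ αN) (hP : 0 ≤ P) (hQ : 0 ≤ Q) (hc₁ : 0 ≤ c₁) (hc₂ : 0 ≤ c₂)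
    (hc₃ : 0 ≤ c₃) (hc₄ : 0 ≤ c₄) (ha : 0 ≤ a)
    (hφ2 : ((L : ℝ) ^ k) ^ d * dirSq φ (periodBox (d := d) N) ≤ P ^ 2 * α₀ ^ 2 * ((L : ℝ) ^ k) ^ 4 * dirSq X₀ (periodBox (d := d) (N * L ^ k)))
    (hφ1 : ((L : ℝ) ^ k) ^ d * dirL1 φ (periodBox (d := d) N) ≤ Q * ((L : ℝ) ^ k) ^ 2 * dirSq X₀ (periodBox (d := d) (N * L ^ k)))
    (hR1 : dirSq Nn (periodBox (d := d) (N * L ^ k)) ≤ c₁ * (((L : ℝ) ^ k) ^ d / ((L : ℝ) ^ k) ^ 2) * dirSq φ (periodBox (d := d) N))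
    (hR2 : curlSq W Nn (periodBox (d := d) (N * L ^ k)) ≤ c₂ * (((L : ℝ) ^ k) ^ d / ((L : ℝ) ^ k) ^ 4) * dirSq φ (periodBox (d := d) N))
    (hR3 : ∑ p ∈ perWin d (N * L ^ k), ‖curl W Nn p‖ ≤ c₃ * (((L : ℝ) ^ k) ^ d / ((L : ℝ) ^ k) ^ 2) * dirL1 φ (periodBox (d := d) N))
    (hR4 : dirL1 Nn (periodBox (d := d) (N * L ^ k)) ≤ c₄ * (((L : ℝ) ^ k) ^ d / (L : ℝ) ^ k) * dirL1 φ (periodBox (d := d) N))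
    (hρ : 2 * (c₁ + c₂) * P ^ 2 * (α₀ * (L : ℝ) ^ k) ^ 2 ≤ 1 / 2) (hJ1 : (α₀ + αN) * (L : ℝ) ^ k ≤ 1) :
    energyNormW L k W Nn (periodBox (d := d) (N * L ^ k))
        ≤ 2 * Real.sqrt (c₁ + c₂) * P * (α₀ * (L : ℝ) ^ k) * energyNormW L k W (fun y μ => Nn y μ - X₀ y μ) (periodBox (d := d) (N * L ^ k)) ∧
      a * ∑ p ∈ perWin d (N * L ^ k), ‖curl W Nn p‖
        ≤ 4 * c₃ * Q * (a * ((L : ℝ) ^ k) ^ 2) * energyNormW L k W (fun y μ => Nn y μ - X₀ y μ) (periodBox (d := d) (N * L ^ k)) ^ 2 ∧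
      a * ((α₀ + αN) * dirL1 Nn (periodBox (d := d) (N * L ^ k)))
        ≤ 4 * c₄ * Q * (a * ((L : ℝ) ^ k) ^ 2) * energyNormW L k W (fun y μ => Nn y μ - X₀ y μ) (periodBox (d := d) (N * L ^ k)) ^ 2 := by
  have hcc : 0 ≤ c₁ + c₂ := add_nonneg hc₁ hc₂
  -- abbreviations as plain reals
  set M : ℝ := (L : ℝ) ^ k with hMdef
  set F := periodBox (d := d) (N * L ^ k) with hFdef
  set T : ℝ := dirSq X₀ F with hTdef
  set EX : ℝ := energyNormW L k W (fun y μ => Nn y μ - X₀ y μ) F with hEXdef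
  set EN : ℝ := energyNormW L k W Nn F with hENdef
  have hM1 : 1 ≤ M := one_le_pow₀ (by exact_mod_cast hL)
  have hM0 : 0 < M := by linarith
  have hMd0 : 0 < M ^ d := by positivity
  have hEX0 : 0 ≤ EX := energyNormW_nonneg L k W _ F
  have hEN0 : 0 ≤ EN := energyNormW_nonneg L k W _ F
  have hT0 : 0 ≤ T := dirSq_nonneg _ _
  -- (e): `EN² = curlSq + M⁻²·dirSq ≤ (c₁+c₂)·(M^d/M⁴)·dirSq φ ≤ (c₁+c₂)P²α₀²·T`
  have hENsq : EN ^ 2 = curlSq W Nn F + (M⁻¹) ^ 2 * dirSq Nn F := by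
    rw [hENdef]; unfold NE3EnergyWeightedShapes.energyNormW
    rw [Real.sq_sqrt (energySq_nonneg L k W Nn F)]
  have hdφ0 : 0 ≤ dirSq φ (periodBox (d := d) N) := dirSq_nonneg _ _
  have hEN2 : EN ^ 2 ≤ (c₁ + c₂) * P ^ 2 * α₀ ^ 2 * T := by
    -- `M^d·EN² ≤ (c₁+c₂)·(M^d)·(M^d/M⁴)·dirSq φ·…`; cleaner: multiply through by `M^d`
    have h1 : (M⁻¹) ^ 2 * dirSq Nn F ≤ (M⁻¹) ^ 2 * (c₁ * (M ^ d / M ^ 2) * dirSq φ (periodBox (d := d) N)) :=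
      mul_le_mul_of_nonneg_left hR1 (by positivity)
    have h2 : (M⁻¹) ^ 2 * (c₁ * (M ^ d / M ^ 2) * dirSq φ (periodBox (d := d) N)) = c₁ * (M ^ d / M ^ 4) * dirSq φ (periodBox (d := d) N) := by
      field_simp
    have h3 : EN ^ 2 ≤ (c₁ + c₂) * (M ^ d / M ^ 4) * dirSq φ (periodBox (d := d) N) := by
      rw [hENsq]
      have h12 := add_le_add hR2 h1
      rw [h2] at h12
      have : c₂ * (M ^ d / M ^ 4) * dirSq φ (periodBox (d := d) N) + c₁ * (M ^ d / M ^ 4) * dirSq φ (periodBox (d := d) N)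
          = (c₁ + c₂) * (M ^ d / M ^ 4) * dirSq φ (periodBox (d := d) N) := by ring
      linarith
    have h4 : (c₁ + c₂) * (M ^ d / M ^ 4) * dirSq φ (periodBox (d := d) N) = (c₁ + c₂) / M ^ 4 * (M ^ d * dirSq φ (periodBox (d := d) N)) := by
      field_simp
    have h5 : (c₁ + c₂) / M ^ 4 * (M ^ d * dirSq φ (periodBox (d := d) N)) ≤ (c₁ + c₂) / M ^ 4 * (P ^ 2 * α₀ ^ 2 * M ^ 4 * T) :=
      mul_le_mul_of_nonneg_left hφ2 (by positivity)
    have h6 : (c₁ + c₂) / M ^ 4 * (P ^ 2 * α₀ ^ 2 * M ^ 4 * T) = (c₁ + c₂) * P ^ 2 * α₀ ^ 2 * T := by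
      field_simp
    exact h3.trans (by rw [h4]; exact h5.trans h6.le)
  -- (c)(d): `T ≤ 2M²(EX² + EN²)`
  have hTle : T ≤ 2 * M ^ 2 * (EX ^ 2 + EN ^ 2) := by
    have h1 : T ≤ 2 * dirSq (fun y μ => Nn y μ - X₀ y μ) F + 2 * dirSq Nn F := by
      have h := dirSq_sub_le_two Nn (fun y μ => Nn y μ - X₀ y μ) F
      have hX₀ : (fun y μ => Nn y μ - (fun y μ => Nn y μ - X₀ y μ) y μ) = X₀ := by funext y μ; simp
      rw [hX₀] at h
      exact h
    have h2 : dirSq (fun y μ => Nn y μ - X₀ y μ) F ≤ M ^ 2 * EX ^ 2 := by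
      rw [hEXdef, hMdef]; exact dirSq_le_pow_sq_mul_energyNormW_sq hL k W (fun y μ => Nn y μ - X₀ y μ) F
    have h3 : dirSq Nn F ≤ M ^ 2 * EN ^ 2 := by
      rw [hENdef, hMdef]; exact dirSq_le_pow_sq_mul_energyNormW_sq hL k W Nn F
    have h4 : 2 * M ^ 2 * (EX ^ 2 + EN ^ 2) = 2 * (M ^ 2 * EX ^ 2) + 2 * (M ^ 2 * EN ^ 2) := by ring
    linarith
  -- absorption: `EN² ≤ ρ²(EX² + EN²)` with `ρ² ≤ 1/2` ⟹ `EN² ≤ 2ρ²·EX²`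
  set ρ2 : ℝ := 2 * (c₁ + c₂) * P ^ 2 * (α₀ * M) ^ 2 with hρ2def
  have hρ2_0 : 0 ≤ ρ2 := by positivity
  have hENρ : EN ^ 2 ≤ ρ2 * (EX ^ 2 + EN ^ 2) := by
    have h1 : (c₁ + c₂) * P ^ 2 * α₀ ^ 2 * T ≤ (c₁ + c₂) * P ^ 2 * α₀ ^ 2 * (2 * M ^ 2 * (EX ^ 2 + EN ^ 2)) :=
      mul_le_mul_of_nonneg_left hTle (by positivity)
    have h2 : (c₁ + c₂) * P ^ 2 * α₀ ^ 2 * (2 * M ^ 2 * (EX ^ 2 + EN ^ 2)) = ρ2 * (EX ^ 2 + EN ^ 2) := by rw [hρ2def]; ring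
    linarith [hEN2]
  have hEN2X : EN ^ 2 ≤ 2 * ρ2 * EX ^ 2 := by
    have h1 : ρ2 * EN ^ 2 ≤ 1 / 2 * EN ^ 2 := mul_le_mul_of_nonneg_right hρ (sq_nonneg EN)
    have h2 : ρ2 * (EX ^ 2 + EN ^ 2) = ρ2 * EX ^ 2 + ρ2 * EN ^ 2 := by ring
    linarith
  -- (N1): `EN ≤ √(2ρ²)·EX = 2√(c₁+c₂)·P·(α₀M)·EX`
  have hN1 : EN ≤ 2 * Real.sqrt (c₁ + c₂) * P * (α₀ * M) * EX := by
    have hK0 : 0 ≤ 2 * Real.sqrt (c₁ + c₂) * P * (α₀ * M) := by positivity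
    have hK2 : (2 * Real.sqrt (c₁ + c₂) * P * (α₀ * M)) ^ 2 = 2 * ρ2 := by
      rw [hρ2def]; simp only [mul_pow, Real.sq_sqrt hcc]; ring
    have h1 : EN ^ 2 ≤ (2 * Real.sqrt (c₁ + c₂) * P * (α₀ * M) * EX) ^ 2 := by rw [mul_pow, hK2]; linarith
    exact (pow_le_pow_iff_left₀ hEN0 (mul_nonneg hK0 hEX0) two_ne_zero).mp h1
  -- `T ≤ 4M²·EX²`
  have hT4 : T ≤ 4 * M ^ 2 * EX ^ 2 := by
    have h1 : M ^ 2 * EN ^ 2 ≤ M ^ 2 * (2 * ρ2 * EX ^ 2) := mul_le_mul_of_nonneg_left hEN2X (by positivity)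
    have h2 : ρ2 * (M ^ 2 * EX ^ 2) ≤ 1 / 2 * (M ^ 2 * EX ^ 2) := mul_le_mul_of_nonneg_right hρ (mul_nonneg (pow_nonneg hM0.le 2) (sq_nonneg EX))
    have h3 : M ^ 2 * (2 * ρ2 * EX ^ 2) = 2 * (ρ2 * (M ^ 2 * EX ^ 2)) := by ring
    have h4 : 2 * M ^ 2 * (EX ^ 2 + EN ^ 2) = 2 * (M ^ 2 * EX ^ 2) + 2 * (M ^ 2 * EN ^ 2) := by ring
    linarith
  -- (N2): the ℓ¹-curl
  have hN2 : a * ∑ p ∈ perWin d (N * L ^ k), ‖curl W Nn p‖ ≤ 4 * c₃ * Q * (a * M ^ 2) * EX ^ 2 := by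
    -- `M^d·Σ‖curl‖ ≤ c₃·(M^d/M²)·(M^d·dirL1 φ)·… `; multiply (R3) by `M^d` and use `hφ1`
    have h1 : M ^ d * ∑ p ∈ perWin d (N * L ^ k), ‖curl W Nn p‖ ≤ c₃ * (M ^ d / M ^ 2) * (M ^ d * dirL1 φ (periodBox (d := d) N)) := by
      have := mul_le_mul_of_nonneg_left hR3 hMd0.le; linarith [this]
    have h2 : c₃ * (M ^ d / M ^ 2) * (M ^ d * dirL1 φ (periodBox (d := d) N)) ≤ c₃ * (M ^ d / M ^ 2) * (Q * M ^ 2 * T) :=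
      mul_le_mul_of_nonneg_left hφ1 (by positivity)
    have h3 : c₃ * (M ^ d / M ^ 2) * (Q * M ^ 2 * T) = M ^ d * (c₃ * Q * T) := by field_simp
    have h4 : ∑ p ∈ perWin d (N * L ^ k), ‖curl W Nn p‖ ≤ c₃ * Q * T :=
      le_of_mul_le_mul_left (h1.trans (h2.trans h3.le)) hMd0
    have h5 : c₃ * Q * T ≤ c₃ * Q * (4 * M ^ 2 * EX ^ 2) := mul_le_mul_of_nonneg_left hT4 (by positivity)
    have h6 := mul_le_mul_of_nonneg_left (h4.trans h5) ha
    linarith [h6]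
  -- (N3): the ℓ¹ size with the (J1) factor
  have hN3 : a * ((α₀ + αN) * dirL1 Nn F) ≤ 4 * c₄ * Q * (a * M ^ 2) * EX ^ 2 := by
    have h1 : M ^ d * dirL1 Nn F ≤ c₄ * (M ^ d / M) * (M ^ d * dirL1 φ (periodBox (d := d) N)) := by
      have := mul_le_mul_of_nonneg_left hR4 hMd0.le; linarith [this]
    have h2 : c₄ * (M ^ d / M) * (M ^ d * dirL1 φ (periodBox (d := d) N)) ≤ c₄ * (M ^ d / M) * (Q * M ^ 2 * T) :=
      mul_le_mul_of_nonneg_left hφ1 (by positivity)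
    have h3 : c₄ * (M ^ d / M) * (Q * M ^ 2 * T) = M ^ d * (c₄ * Q * M * T) := by field_simp
    have h4 : dirL1 Nn F ≤ c₄ * Q * M * T := le_of_mul_le_mul_left (h1.trans (h2.trans h3.le)) hMd0
    have h5 : c₄ * Q * M * T ≤ c₄ * Q * M * (4 * M ^ 2 * EX ^ 2) := mul_le_mul_of_nonneg_left hT4 (by positivity)
    have h6 : (α₀ + αN) * dirL1 Nn F ≤ (α₀ + αN) * (c₄ * Q * M * (4 * M ^ 2 * EX ^ 2)) :=
      mul_le_mul_of_nonneg_left (h4.trans h5) (by positivity)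
    -- `(α₀+αN)·M ≤ 1`
    have h7 : (α₀ + αN) * (c₄ * Q * M * (4 * M ^ 2 * EX ^ 2)) = ((α₀ + αN) * M) * (4 * c₄ * Q * M ^ 2 * EX ^ 2) := by ring
    have h8 : ((α₀ + αN) * M) * (4 * c₄ * Q * M ^ 2 * EX ^ 2) ≤ 1 * (4 * c₄ * Q * M ^ 2 * EX ^ 2) :=
      mul_le_mul_of_nonneg_right hJ1 (mul_nonneg (by positivity : (0:ℝ) ≤ 4 * c₄ * Q * M ^ 2) (sq_nonneg EX))
    have h9 := mul_le_mul_of_nonneg_left (h6.trans (by linarith [h7, h8] : _ ≤ 1 * (4 * c₄ * Q * M ^ 2 * EX ^ 2))) ha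
    linarith [h9]
  exact ⟨hN1, hN2, hN3⟩

end

end Summit.QuantumFields.BalabanUV.T4Continuum.NE3.PreSizesOfSizesB8
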